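import Summits.QuantumFields.BalabanUV.T4Continuum.Support.RegionLocalInjectedAssembly
import Summits.QuantumFields.BalabanUV.T4Continuum.Support.RegionLocalBudgets
import Summits.QuantumFields.BalabanUV.T4Continuum.Support.RegionGaugeColumnsTrace

/-!
# T⁴ programme, spine node NE2 (U1a), sub-row Δ1 «NE2⁰-Dirichlet» — THE END OF RECORD OF THE BOX STAR TOWER OF THE FAITHFUL `Δ_a(Ω₀)`:
# MODULO EXACTLY (P-W) AND (B) — leaf (Bᵗ) removed by `hBt_of_hB`, the (R-loc) socket by leaf-02-g8's `hRH_box`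

NE2 formalisation swarm `b2b-balaban-t4-ne2-formalise-*`, LEAF PROVER 06 (gen 7), supplier item «Δ1-VEC-BT-TRACE», junction file (file 2
of 2; file 1: `Support/RegionGaugeColumnsTrace` — `JᴴJ = 1 − (1 − L⁻¹)•P_def`, the deficient-layer trace `‖P_def·B̂_k‖ ≤ √(2Λ/n_k)`,
`hBt_of_hB`).  The row OWNER's O15-c `RegionLocalInjectedAssembly.towerLimitRate_star_renorm_box_of_WPairing` (gen 15) is O15-a's END with
leaf (L) assembled from the Gaffney pairing (P-W) + the Hessian budget (R-loc) (+ (P-mass), (K) consumed BY NAME) and the gauge-column leaves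
(B), (Bᵗ) displayed.  THIS FILE (owner R39 (b) «GO … ALSO discharge hRH there») feeds `hBt := hBt_of_hB … hB` into it —
**`hinjK_of_WPairing_of_hB`**, **`towerLimitRate_star_renorm_box_of_WPairing_of_hB`** (modulo (P-W), (R-loc), (B); `Cbt := Cbt d L a′ Cb =
Cb + (1 − L⁻¹)√(2Λ)`) — and then the (R-loc) socket `hRH := RegionLocalBudgets.hRH_box` (leaf-02-g8 p239774, `CH := CHbox d a a′ = 1 + (a + 7d)γ⋆⁻¹`):
**`hinjK_box_of_WPairing_hB`** and THE END OF RECORD **`towerLimitRate_star_renorm_box_of_WPairing_hB`** — the renormalised box star tower of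
the faithful `Δ_a(Ω₀)` at every rate `θ ∈ [(√L)⁻¹, 1)` MODULO EXACTLY (P-W) [leaf-03-g8 P3∕P5 + leaf-01-g10 P4] and (B) [leaf-05-g9].

HONEST FRAMING (T4-DAG p. 1).  Pure bookkeeping over landed modules ([folklore]); model level (`U = 1`, ONE region = a coordinate box, ONE
averaging scale, finite torus, linear layer, operator norm); (P-W) and (B) are DISPLAYED, not proved ((R-loc), (Bᵗ)⇐(B), (K), (P-mass)
are theorems consumed BY NAME); `hinjK` / W3 on boxes OPEN; Δ1
NOT closed; NE2 (U1a) NOT proved; spine PROVED 0/9 unchanged; NOT [B9] (3.16)/(3.23)–(3.27)/(3.42) as printed; NOT infinite volume / mass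
gap / Clay.  HONEST DEPENDENCY: continuum YM on T⁴ ⇐ BetaPertH ∧ nine spine estimates (0/9 proved); BetaPertH ⇐ (D1) ∧ (D4) ∧ CAP+tail;
G-an2-4 gates asym, D1 and NE2/3/4.  No `sorry`.
-/

noncomputable section

open scoped BigOperators ComplexConjugate Matrix Matrix.Norms.L2Operator

namespace Summit.QuantumFields.BalabanUV.T4Continuum.RegionLocalInjectedAssemblyTrace

open Literature.MathematicalPhysics.QuantumFieldTheory.Balaban1983to89.B5Prop11Plancherel (Tor fine)
open Literature.MathematicalPhysics.QuantumFieldTheory.Balaban1983to89.B5Prop11Lower (nsq)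
open Literature.MathematicalPhysics.QuantumFieldTheory.Balaban1983to89.B5G183RateUnitTower (lev)
open Summit.QuantumFields.BalabanUV.T4Continuum
open Summit.QuantumFields.BalabanUV.T4Continuum.CovariantAveragingTower (TowerLimitRate)
open Summit.QuantumFields.BalabanUV.T4Continuum.BackgroundResolventTower (Cpert)
open Summit.QuantumFields.BalabanUV.T4Continuum.RegionScalarCompression (KcompR)
open Summit.QuantumFields.BalabanUV.T4Continuum.RegionGaugeFixedVector (starReg regionDeltaA)
open Summit.QuantumFields.BalabanUV.T4Continuum.DirichletSubregionTowerOf (pidx JpR)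
open Summit.QuantumFields.BalabanUV.T4Continuum.DirichletSubregionRenormTower (AnR)
open Summit.QuantumFields.BalabanUV.T4Continuum.DirichletStarVectorTower (starP gamStar)
open Summit.QuantumFields.BalabanUV.T4Continuum.RegionInteriorW2 (CgIbox)
open Summit.QuantumFields.BalabanUV.T4Continuum.RegionSliceCoerciveBoxTower (cW1box)
open Summit.QuantumFields.BalabanUV.T4Continuum.RegionElectricSplitting (Wdir)
open Summit.QuantumFields.BalabanUV.T4Continuum.RegionGaugeResolventSplit (regionBh regionDeltaLoc)
open Summit.QuantumFields.BalabanUV.T4Continuum.RegionGaugeResolventTower (C1loc hinjK_of_local)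
open Summit.QuantumFields.BalabanUV.T4Continuum.RegionLocalInjectedAssembly (Ebud ClW CKbox hloc_of_WPairing hK_box inv_le_of_sqrt_inv_le
  towerLimitRate_star_renorm_box_of_WPairing)
open Summit.QuantumFields.BalabanUV.T4Continuum.RegionGaugeColumnsTrace (Cbt hBt_of_hB)
open Summit.QuantumFields.BalabanUV.T4Continuum.RegionLocalBudgets (CHbox hRH_box)
open Summit.QuantumFields.BalabanUV.Beta.GAN24.DirichletBoxTwoLevel (IsCoordBox)

variable {d : ℕ} (L : ℕ) [NeZero L] (M : Fin d → ℕ) [hM : ∀ μ, NeZero (M μ)] (S : Tor M → Prop) [DecidablePred S] (a a' : ℝ)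

/-- **KING's COMPRESSED INJECTED LAW OF THE FAITHFUL `Δ_a(Ω₀)` ON A COORDINATE BOX MODULO EXACTLY (P-W), (R-loc), (B)** at rate
`θ ≥ (√L)⁻¹` (`2 ≤ L`, `0 < a`, `0 < a′`, `0 ≤ Cb`): the owner's `hinjK_of_local` with (L) := `hloc_of_WPairing`, (Bᵗ) := `hBt_of_hB`,
(K) := `hK_box`. [folklore] -/
theorem hinjK_of_WPairing_of_hB (hL : 2 ≤ L) (hbox : IsCoordBox M S) (ha : 0 < a) (ha' : 0 < a')
    {θ CW CH Cb : ℝ} (hθ : (Real.sqrt L)⁻¹ ≤ θ)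
    {εW : ℕ → ℝ} (hεW : ∀ k, 0 ≤ εW k) (hrate : ∀ k, εW k ≤ CW * θ ^ k)
    (hPW : ∀ (k : ℕ) (u : pidx L M (starP L M S) k → ℂ) (v : pidx L M (starP L M S) (k + 1) → ℂ),
      ‖star v ⬝ᵥ ((JpR L M (starP L M S) k * regionDeltaLoc (lev L k) M 0 S
          - regionDeltaLoc (lev L (k + 1)) M 0 S * JpR L M (starP L M S) k) *ᵥ u)‖
        ≤ εW k * Real.sqrt (Ebud (lev L k) M a S u) * Real.sqrt (Ebud (lev L (k + 1)) M a S v))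
    (hRH : ∀ (k : ℕ) (f : pidx L M (starP L M S) k → ℂ),
      ∑ μ, nsq (Wdir (lev L k) M S μ *ᵥ ((regionDeltaLoc (lev L k) M a S)⁻¹ *ᵥ f)) ≤ CH ^ 2 * nsq f)
    (hCb : 0 ≤ Cb)
    (hB : ∀ k, ‖regionBh (lev L (k + 1)) M a' S - JpR L M (starP L M S) k * regionBh (lev L k) M a' S‖ ≤ Cb * θ ^ k) (k : ℕ) :
    ‖(regionDeltaA (lev L (k + 1)) M a a' S)⁻¹ * JpR L M (starP L M S) k
        - JpR L M (starP L M S) k * (regionDeltaA (lev L k) M a a' S)⁻¹‖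
      ≤ C1loc d a a' (ClW d a a' CW CH) Cb (Cbt d L a' Cb) (CKbox d L a') * θ ^ k :=
  hinjK_of_local L M S a a' hL hbox ha ha' (le_trans (inv_nonneg.mpr (Real.sqrt_nonneg _)) hθ) hCb
    (hloc_of_WPairing L M S a a' hL hbox ha ha' hθ hεW hrate hPW hRH) hB
    (hBt_of_hB L M S a' (le_trans (by norm_num) hL) hbox ha' hθ hB)
    (hK_box L M S a' hbox ha' (inv_le_of_sqrt_inv_le L (le_trans (by norm_num) hL) hθ)) k

/-- **THE RENORMALISED STAR TOWER OF THE FAITHFUL `Δ_a(Ω₀)` ON A COORDINATE BOX AT RATE `θ ∈ [(√L)⁻¹, 1)` MODULO EXACTLY (P-W),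
(R-loc), (B)** — the owner's `towerLimitRate_star_renorm_box_of_WPairing` with `hBt := hBt_of_hB … hB` (`Cbt = Cb + (1 − L⁻¹)√(2Λ)`).
[folklore] -/
theorem towerLimitRate_star_renorm_box_of_WPairing_of_hB (hL : 2 ≤ L) (hbox : IsCoordBox M S) (ha : 0 < a) (ha' : 0 < a')
    {θ CW CH Cb : ℝ} (hθ : (Real.sqrt L)⁻¹ ≤ θ) (hθ1 : θ < 1)
    {εW : ℕ → ℝ} (hεW : ∀ k, 0 ≤ εW k) (hrate : ∀ k, εW k ≤ CW * θ ^ k)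
    (hPW : ∀ (k : ℕ) (u : pidx L M (starP L M S) k → ℂ) (v : pidx L M (starP L M S) (k + 1) → ℂ),
      ‖star v ⬝ᵥ ((JpR L M (starP L M S) k * regionDeltaLoc (lev L k) M 0 S
          - regionDeltaLoc (lev L (k + 1)) M 0 S * JpR L M (starP L M S) k) *ᵥ u)‖
        ≤ εW k * Real.sqrt (Ebud (lev L k) M a S u) * Real.sqrt (Ebud (lev L (k + 1)) M a S v))
    (hRH : ∀ (k : ℕ) (f : pidx L M (starP L M S) k → ℂ),
      ∑ μ, nsq (Wdir (lev L k) M S μ *ᵥ ((regionDeltaLoc (lev L k) M a S)⁻¹ *ᵥ f)) ≤ CH ^ 2 * nsq f)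
    (hCb : 0 ≤ Cb)
    (hB : ∀ k, ‖regionBh (lev L (k + 1)) M a' S - JpR L M (starP L M S) k * regionBh (lev L k) M a' S‖ ≤ Cb * θ ^ k) :
    TowerLimitRate (AnR L M (starP L M S)) ((L : ℝ) ^ d) (fun k => (regionDeltaA (lev L k) M a a' S)⁻¹)
      (Cpert 0 (Real.sqrt (CgIbox d a' (cW1box d a a' 4) / 2 * (gamStar d a' (cW1box d a a' 4))⁻¹))
        (Real.sqrt L * C1loc d a a' (ClW d a a' CW CH) Cb (Cbt d L a' Cb) (CKbox d L a') + (2 * (Real.sqrt L - 1)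
          * Real.sqrt ((2 * (gamStar d a' (cW1box d a a' 4))⁻¹ + CgIbox d a' (cW1box d a a' 4)) * (gamStar d a' (cW1box d a a' 4))⁻¹))) 0 0 0) θ :=
  towerLimitRate_star_renorm_box_of_WPairing L M S a a' hL hbox ha ha' hθ hθ1 hεW hrate hPW hRH hCb hB
    (hBt_of_hB L M S a' (le_trans (by norm_num) hL) hbox ha' hθ hB)

/-! ## The (R-loc) socket discharged too: the END of record modulo (P-W) and (B) -/

/-- **KING's COMPRESSED INJECTED LAW OF THE FAITHFUL `Δ_a(Ω₀)` ON A COORDINATE BOX MODULO EXACTLY (P-W) AND (B)** at rate `θ ≥ (√L)⁻¹`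
(`2 ≤ L`, `0 < a`, `0 < a′`, `0 ≤ Cb`): `hinjK_of_WPairing_of_hB` with `hRH := RegionLocalBudgets.hRH_box` (`CH = CHbox d a a′`). [folklore] -/
theorem hinjK_box_of_WPairing_hB (hL : 2 ≤ L) (hbox : IsCoordBox M S) (ha : 0 < a) (ha' : 0 < a')
    {θ CW Cb : ℝ} (hθ : (Real.sqrt L)⁻¹ ≤ θ)
    {εW : ℕ → ℝ} (hεW : ∀ k, 0 ≤ εW k) (hrate : ∀ k, εW k ≤ CW * θ ^ k)
    (hPW : ∀ (k : ℕ) (u : pidx L M (starP L M S) k → ℂ) (v : pidx L M (starP L M S) (k + 1) → ℂ),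
      ‖star v ⬝ᵥ ((JpR L M (starP L M S) k * regionDeltaLoc (lev L k) M 0 S
          - regionDeltaLoc (lev L (k + 1)) M 0 S * JpR L M (starP L M S) k) *ᵥ u)‖
        ≤ εW k * Real.sqrt (Ebud (lev L k) M a S u) * Real.sqrt (Ebud (lev L (k + 1)) M a S v))
    (hCb : 0 ≤ Cb)
    (hB : ∀ k, ‖regionBh (lev L (k + 1)) M a' S - JpR L M (starP L M S) k * regionBh (lev L k) M a' S‖ ≤ Cb * θ ^ k) (k : ℕ) :
    ‖(regionDeltaA (lev L (k + 1)) M a a' S)⁻¹ * JpR L M (starP L M S) k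
        - JpR L M (starP L M S) k * (regionDeltaA (lev L k) M a a' S)⁻¹‖
      ≤ C1loc d a a' (ClW d a a' CW (CHbox d a a')) Cb (Cbt d L a' Cb) (CKbox d L a') * θ ^ k :=
  hinjK_of_WPairing_of_hB L M S a a' hL hbox ha ha' hθ hεW hrate hPW (hRH_box L M S a a' hL hbox ha ha') hCb hB k

/-- **THE END OF RECORD: THE RENORMALISED STAR TOWER OF THE FAITHFUL `Δ_a(Ω₀)` ON A COORDINATE BOX AT RATE `θ ∈ [(√L)⁻¹, 1)` MODULO
EXACTLY (P-W) AND (B)** — the owner's `towerLimitRate_star_renorm_box_of_WPairing` with `hRH := RegionLocalBudgets.hRH_box` (leaf-02-g8)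
and `hBt := hBt_of_hB … hB` (this lineage); W1, interior W2, PF, W3̃ ⟺ W3, the resolvent split, (P-mass), (K) all consumed BY NAME upstream.
[folklore] -/
theorem towerLimitRate_star_renorm_box_of_WPairing_hB (hL : 2 ≤ L) (hbox : IsCoordBox M S) (ha : 0 < a) (ha' : 0 < a')
    {θ CW Cb : ℝ} (hθ : (Real.sqrt L)⁻¹ ≤ θ) (hθ1 : θ < 1)
    {εW : ℕ → ℝ} (hεW : ∀ k, 0 ≤ εW k) (hrate : ∀ k, εW k ≤ CW * θ ^ k)
    (hPW : ∀ (k : ℕ) (u : pidx L M (starP L M S) k → ℂ) (v : pidx L M (starP L M S) (k + 1) → ℂ),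
      ‖star v ⬝ᵥ ((JpR L M (starP L M S) k * regionDeltaLoc (lev L k) M 0 S
          - regionDeltaLoc (lev L (k + 1)) M 0 S * JpR L M (starP L M S) k) *ᵥ u)‖
        ≤ εW k * Real.sqrt (Ebud (lev L k) M a S u) * Real.sqrt (Ebud (lev L (k + 1)) M a S v))
    (hCb : 0 ≤ Cb)
    (hB : ∀ k, ‖regionBh (lev L (k + 1)) M a' S - JpR L M (starP L M S) k * regionBh (lev L k) M a' S‖ ≤ Cb * θ ^ k) :
    TowerLimitRate (AnR L M (starP L M S)) ((L : ℝ) ^ d) (fun k => (regionDeltaA (lev L k) M a a' S)⁻¹)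
      (Cpert 0 (Real.sqrt (CgIbox d a' (cW1box d a a' 4) / 2 * (gamStar d a' (cW1box d a a' 4))⁻¹))
        (Real.sqrt L * C1loc d a a' (ClW d a a' CW (CHbox d a a')) Cb (Cbt d L a' Cb) (CKbox d L a') + (2 * (Real.sqrt L - 1)
          * Real.sqrt ((2 * (gamStar d a' (cW1box d a a' 4))⁻¹ + CgIbox d a' (cW1box d a a' 4)) * (gamStar d a' (cW1box d a a' 4))⁻¹))) 0 0 0) θ :=
  towerLimitRate_star_renorm_box_of_WPairing_of_hB L M S a a' hL hbox ha ha' hθ hθ1 hεW hrate hPW (hRH_box L M S a a' hL hbox ha ha') hCb hB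

end Summit.QuantumFields.BalabanUV.T4Continuum.RegionLocalInjectedAssemblyTrace

end
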